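import Literature.Computability.Complexity.CircuitCounting
import Literature.Computability.Complexity.CircuitSizeProofs
import Literature.Computability.Complexity.Williams2014
import Literature.Computability.MetaComplexity.TruthTablesProofs
import HarnessLib

/-!
# A hard Boolean function by counting, bit by bit, and the diagonal language of
# Murray–Williams 2018, Thm. 2.3 (combinatorial half)

Murray–Williams 2018, Thm. 2.3 (C. D. Murray, R. R. Williams, *Circuit lower bounds for
nondeterministic quasi-polytime*, STOC 2018 / ECCC TR17-188, §2, "folklore"): for `s(n) < 2ⁿ/(2n)`
there is a language `L_diag ∈ SPACE[s(n)²]` without `s(n)`-size circuits at all but finitely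
many lengths; printed proof: on inputs of length `n`, find "the lexicographically first function
`fₙ : {0,1}^{2 log s(n)} → {0,1}` … that is not computable by any circuit of size `s(n)`. Then the
padded language `L_diag = ⋃ₙ {x : |x| = n ∧ fₙ(first 2 log s(n) bits of x) = 1}` does not have
`s(n)`-size circuits". This is the diagonal language consumed by the protocol of Thm. 3.1
(`MurrayWilliams2018AlmostAE.lean`, hypothesis `hdiag`; `MurrayWilliams2018HardLanguage.lean`).

This file builds such a family of hard functions and the padded language, and PROVES the circuit
lower bound at EVERY length satisfying the two numerical side conditions (no machine is
programmed: the `SPACE[s²]` half of Thm. 2.3 — or, for a counting-based instantiation of Thm. 3.1,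
the computation of the table with `#P`-type queries — is left to the consumer). Instead of the
lexicographically first hard table we take the table found GREEDILY BY COUNTING, which is the
form suited to such a computation: writing `E(p)` for the number of codes of `B₂`-circuits of
size `≤ S` on `ℓ` inputs (`CircuitCount.Code ℓ S`, `CircuitCounting.lean`) whose truth table
extends the prefix `p`, the next bit is the one with FEWER consistent codes
(`b = [E(p1) < E(p0)]`), so that `E` at least halves at each of the `2^ℓ` bits
(`consistent_greedy_mul_le`: `E(greedy k) · 2ᵏ ≤ #Code`); if `#Code ℓ S < 2^{2^ℓ}` no code
survives, i.e. no `B₂`-circuit of size `≤ S` computes the function `hardFn ℓ S` with this truth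
table (`not_computes_hardFn`, `lt_circuitSizeOver_hardFn`). The padded language
`lang ℓ s = {x : ℓ(|x|) ≤ |x|, hardFn (ℓ |x|) (s |x| + 2) (first ℓ(|x|) bits of x) = 1}` then
has circuit complexity `> s(n)` at every length `n` with `ℓ(n) ≤ n` and
`#Code (ℓ n) (s n + 2) < 2^{2^{ℓ n}}` (`lt_circuitSize_lang`: a circuit for the slice, with its
last `n - ℓ(n)` inputs hard-wired to `0` at the cost of two gates, `Circuit.exists_hardwire`,
would compute `hardFn`). With the printed number of variables, `2^ℓ ≈ s²`
(`ellOf S = ⌈log₂ (S+2)²⌉`, `card_code_lt_two_pow_of_le`: `#Code ℓ S < 2^{2^ℓ}` once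
`(S+2)² ≤ 2^ℓ` and `S ≥ 32`), this gives **`lt_circuitSize_diag`**: for every `n` with
`30 ≤ s(n)` and `(s(n) + 4)² ≤ 2ⁿ` (i.e. `2 log s ≤ n`, as the printed construction needs),
`s(n) < (diag s).circuitSize n`, and its eventual form `eventually_lt_circuitSize_diag`.

* `consistent ℓ S p` (`E(p)`), `prefix_append_singleton_iff`, `consistent_append_add`
  (`E(p0) + E(p1) = E(p)` for `|p| < 2^ℓ`);
* `greedy ℓ S k` (the first `k` bits), `table ℓ S` (all `2^ℓ` bits), `hardFn ℓ S`;
* `consistent_greedy_mul_le`, `consistent_table_eq_zero`, `not_computes_hardFn`,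
  `lt_circuitSizeOver_hardFn`;
* `lang ℓ s`, `lt_circuitSize_lang`; `ellOf`, `card_code_lt_two_pow_of_le`, `diag s`,
  `lt_circuitSize_diag`, `eventually_lt_circuitSize_diag`.

Definitions with bodies and theorems only; no named fact is introduced.

## References

* C. D. Murray, R. R. Williams, *Circuit lower bounds for nondeterministic quasi-polytime: an easy
  witness lemma for NP and NQP*, STOC 2018 (ECCC TR17-188), Thm. 2.3 and its proof sketch
  [MurrayWilliams2018].
* S. Arora, B. Barak, *Computational Complexity: A Modern Approach*, CUP 2009, Thm. 6.21 (counting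
  circuits; existence of hard functions) [AroraBarakCC2009].
-/

noncomputable section

namespace Literature.Computability.Complexity

open Finset Filter

namespace GreedyHard

open CircuitCount MetaComplexity

variable {ℓ S : ℕ}

/-! ### Counting the codes consistent with a prefix -/

open scoped Classical in
/-- `E(p)`: the number of codes of `B₂`-circuits of size `≤ S` on `ℓ` inputs whose truth table
(`MetaComplexity.truthTable`, `2^ℓ` bits) has the prefix `p`. [folklore] -/
def consistent (ℓ S : ℕ) (p : List Bool) : ℕ :=
  (univ.filter fun c : Code ℓ S => p <+: truthTable (decode c)).card

/-- `E(p) ≤ #Code`. [folklore] -/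
theorem consistent_le_card (p : List Bool) : consistent ℓ S p ≤ Fintype.card (Code ℓ S) := by
  classical
  unfold consistent
  exact (card_filter_le _ _).trans (by rw [card_univ])

/-- A one-bit extension of a proper prefix: `p b` is a prefix of `t` iff `p` is and the next
letter of `t` is `b`. [folklore] -/
theorem prefix_append_singleton_iff {α : Type*} {p t : List α} {b : α} (h : p.length < t.length) :
    p ++ [b] <+: t ↔ p <+: t ∧ t[p.length] = b := by
  constructor
  · rintro ⟨r, hr⟩
    refine ⟨⟨[b] ++ r, by rw [← List.append_assoc, hr]⟩, ?_⟩
    subst hr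
    simp
  · rintro ⟨⟨r, hr⟩, hb⟩
    subst hr
    cases r with
    | nil => simp at h
    | cons a r =>
      refine ⟨r, ?_⟩
      have : a = b := by simpa using hb
      subst this
      simp

/-- **`E(p0) + E(p1) = E(p)`** for a prefix shorter than the tables: every consistent code
extends `p` by exactly one next bit. [folklore] -/
theorem consistent_append_add {p : List Bool} (hp : p.length < 2 ^ ℓ) :
    consistent ℓ S (p ++ [false]) + consistent ℓ S (p ++ [true]) = consistent ℓ S p := by
  classical
  unfold consistent
  have hlen : ∀ c : Code ℓ S, p.length < (truthTable (decode c)).length := fun c => by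
    rw [length_truthTable]; exact hp
  have hF : (univ.filter fun c : Code ℓ S => p ++ [false] <+: truthTable (decode c)) =
      (univ.filter fun c : Code ℓ S => p <+: truthTable (decode c)).filter
        fun c => (truthTable (decode c))[p.length]'(hlen c) = false := by
    ext c
    simp only [mem_filter, mem_univ, true_and, prefix_append_singleton_iff (hlen c)]
  have hT : (univ.filter fun c : Code ℓ S => p ++ [true] <+: truthTable (decode c)) =
      (univ.filter fun c : Code ℓ S => p <+: truthTable (decode c)).filter
        fun c => ¬ (truthTable (decode c))[p.length]'(hlen c) = false := by
    ext c
    simp only [mem_filter, mem_univ, true_and, prefix_append_singleton_iff (hlen c),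
      Bool.not_eq_false]
  rw [hF, hT]
  exact card_filter_add_card_filter_not _

/-! ### The greedy table -/

/-- **The greedy prefix of length `k`**: each new bit is the one with fewer consistent codes
(`1` iff `E(p1) < E(p0)`). [folklore] -/
def greedy (ℓ S : ℕ) : ℕ → List Bool
  | 0 => []
  | k + 1 => greedy ℓ S k ++
      [decide (consistent ℓ S (greedy ℓ S k ++ [true]) < consistent ℓ S (greedy ℓ S k ++ [false]))]

/-- The greedy prefix of length `k` has length `k`. [folklore] -/
@[simp] theorem length_greedy (k : ℕ) : (greedy ℓ S k).length = k := by
  induction k with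
  | zero => rfl
  | succ k ih => simp [greedy, ih]

/-- **Halving**: `E(greedy (k+1)) · 2 ≤ E(greedy k)` while `k < 2^ℓ`. [folklore] -/
theorem two_mul_consistent_greedy_succ_le {k : ℕ} (hk : k < 2 ^ ℓ) :
    2 * consistent ℓ S (greedy ℓ S (k + 1)) ≤ consistent ℓ S (greedy ℓ S k) := by
  have hsplit := consistent_append_add (S := S) (p := greedy ℓ S k) (by simpa using hk)
  simp only [greedy]
  by_cases h : consistent ℓ S (greedy ℓ S k ++ [true]) < consistent ℓ S (greedy ℓ S k ++ [false])
  · rw [decide_eq_true h]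
    omega
  · rw [decide_eq_false h]
    omega

/-- **The counting invariant**: `E(greedy k) · 2ᵏ ≤ #Code` for `k ≤ 2^ℓ`. [folklore] -/
theorem consistent_greedy_mul_le {k : ℕ} (hk : k ≤ 2 ^ ℓ) :
    consistent ℓ S (greedy ℓ S k) * 2 ^ k ≤ Fintype.card (Code ℓ S) := by
  induction k with
  | zero =>
    rw [pow_zero, mul_one]
    exact consistent_le_card _
  | succ k ih =>
    have h2 := two_mul_consistent_greedy_succ_le (S := S) (Nat.lt_of_succ_le hk)
    calc consistent ℓ S (greedy ℓ S (k + 1)) * 2 ^ (k + 1)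
        = 2 * consistent ℓ S (greedy ℓ S (k + 1)) * 2 ^ k := by ring
      _ ≤ consistent ℓ S (greedy ℓ S k) * 2 ^ k := Nat.mul_le_mul_right _ h2
      _ ≤ Fintype.card (Code ℓ S) := ih (Nat.le_of_succ_le hk)

/-- **The greedy table**: all `2^ℓ` bits. [folklore] -/
def table (ℓ S : ℕ) : List Bool :=
  greedy ℓ S (2 ^ ℓ)

/-- The greedy table has length `2^ℓ`. [folklore] -/
@[simp] theorem length_table : (table ℓ S).length = 2 ^ ℓ :=
  length_greedy _

/-- **No code survives** if there are fewer codes than tables: `E(table) = 0` when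
`#Code ℓ S < 2^{2^ℓ}`. [folklore] -/
theorem consistent_table_eq_zero (h : Fintype.card (Code ℓ S) < 2 ^ 2 ^ ℓ) :
    consistent ℓ S (table ℓ S) = 0 := by
  have hinv := consistent_greedy_mul_le (ℓ := ℓ) (S := S) (k := 2 ^ ℓ) le_rfl
  by_contra hne
  change consistent ℓ S (greedy ℓ S (2 ^ ℓ)) ≠ 0 at hne
  have h2 : 2 ^ 2 ^ ℓ ≤ consistent ℓ S (greedy ℓ S (2 ^ ℓ)) * 2 ^ 2 ^ ℓ :=
    Nat.le_mul_of_pos_left _ (Nat.pos_of_ne_zero hne)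
  omega

/-- **The hard function** `hardFn ℓ S : {0,1}^ℓ → {0,1}`: the Boolean function whose truth table
is the greedy table (Murray–Williams' `fₙ`, found by counting instead of lexicographically).
[cite: MurrayWilliams2018, Thm. 2.3 (proof)] -/
def hardFn (ℓ S : ℕ) : (Fin ℓ → Bool) → Bool :=
  ofTruthTable (table ℓ S) length_table

/-- The truth table of `hardFn` is the greedy table. [folklore] -/
@[simp] theorem truthTable_hardFn : truthTable (hardFn ℓ S) = table ℓ S :=
  truthTable_ofTruthTable _ _

/-- **No `B₂`-circuit of size `≤ S` computes `hardFn ℓ S`** when `#Code ℓ S < 2^{2^ℓ}`: such a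
circuit is the decoding of a code (`CircuitCount.exists_code`), whose truth table would be the
greedy table, but no code is consistent with the whole table. [cite: MurrayWilliams2018, Thm. 2.3] -/
theorem not_computes_hardFn (h : Fintype.card (Code ℓ S) < 2 ^ 2 ^ ℓ) (C : Circuit (Fin ℓ))
    (hB : C.IsOver B2) (hs : C.size ≤ S) : ¬ C.Computes (hardFn ℓ S) := by
  classical
  intro hC
  obtain ⟨c, hc⟩ := exists_code C hB hs
  have hfun : decode c = hardFn ℓ S := by rw [hc]; funext x; exact hC x
  have hmem : c ∈ univ.filter fun c : Code ℓ S => table ℓ S <+: truthTable (decode c) := by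
    simp only [mem_filter, mem_univ, true_and, hfun, truthTable_hardFn]
    exact List.prefix_rfl
  have hpos : 0 < consistent ℓ S (table ℓ S) := card_pos.2 ⟨c, hmem⟩
  have := consistent_table_eq_zero h
  omega

/-- **The circuit complexity of `hardFn ℓ S` exceeds `S`** when `#Code ℓ S < 2^{2^ℓ}` (the
minimum over `B₂` is attained, `MetaComplexity.exists_computes_B2_size_eq_holds`).
[cite: MurrayWilliams2018, Thm. 2.3] -/
theorem lt_circuitSizeOver_hardFn (h : Fintype.card (Code ℓ S) < 2 ^ 2 ^ ℓ) :
    S < circuitSizeOver B2 (hardFn ℓ S) := by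
  by_contra hle
  rw [not_lt] at hle
  obtain ⟨C, hB, hC, hsize⟩ := exists_computes_B2_size_eq_holds (hardFn ℓ S)
  exact not_computes_hardFn h C hB (hsize ▸ hle) hC

/-! ### The padded diagonal language -/

/-- **The diagonal language** (Murray–Williams 2018, Thm. 2.3:
"`L_diag = ⋃ₙ {x : |x| = n ∧ fₙ(first bits of x) = 1}`"): at length `n`, read the hard
function on `ℓ(n)` variables against size `s(n) + 2` (two spare gates for the tree's hard-wiring
of the padding) on the first `ℓ(n)` bits of the input; empty slice if `ℓ(n) > n`.
[cite: MurrayWilliams2018, Thm. 2.3] -/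
def lang (ℓ s : ℕ → ℕ) : Language Bool :=
  {x | ℓ x.length ≤ x.length ∧
    hardFn (ℓ x.length) (s x.length + 2) (fun i : Fin (ℓ x.length) => x.getD i false) = true}

/-- Unfolding membership in `lang` at a given length. [folklore] -/
theorem mem_lang_iff {ℓ s : ℕ → ℕ} {x : List Bool} {n : ℕ} (hx : x.length = n) :
    x ∈ lang ℓ s ↔ ℓ n ≤ n ∧ hardFn (ℓ n) (s n + 2) (fun i : Fin (ℓ n) => x.getD i false) = true := by
  subst hx
  rfl

/-- Reading a table given as `List.ofFn y ++ w` at an address `< |y|`. [folklore] -/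
theorem getD_ofFn_append {m : ℕ} (y : Fin m → Bool) (w : List Bool) {i : ℕ} (hi : i < m) :
    (List.ofFn y ++ w).getD i false = y ⟨i, hi⟩ := by
  rw [List.getD_eq_getElem?_getD, List.getElem?_append_left (by simpa using hi)]
  simp [hi]

/-- **The diagonal language defeats every small circuit, at every good length**
(Murray–Williams 2018, Thm. 2.3: "does not have `s(n)`-size circuits"): if `ℓ(n) ≤ n` and
`#Code (ℓ n) (s n + 2) < 2^{2^{ℓ n}}` then `s(n) < (lang ℓ s).circuitSize n` — an optimal
circuit for the slice with its inputs `ℓ(n), …, n - 1` hard-wired to `0`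
(`Circuit.exists_hardwire`, two more gates) would compute `hardFn (ℓ n) (s n + 2)` with at most
`s(n) + 2` gates. [cite: MurrayWilliams2018, Thm. 2.3] -/
theorem lt_circuitSize_lang {ℓ s : ℕ → ℕ} {n : ℕ} (hℓ : ℓ n ≤ n)
    (hcard : Fintype.card (Code (ℓ n) (s n + 2)) < 2 ^ 2 ^ ℓ n) :
    s n < (lang ℓ s).circuitSize n := by
  by_contra hle
  rw [not_lt] at hle
  obtain ⟨C, hCB, hCf, hCs⟩ := exists_circuit_size_eq_circuitSize (lang ℓ s) n
  let σ : Fin n → Fin (ℓ n) ⊕ Bool := fun j =>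
    if h : (j : ℕ) < ℓ n then Sum.inl ⟨j, h⟩ else Sum.inr false
  -- the constants `0 = ∨₀`, `1 = ∧₀` are `B₂` gates (arity `0 ≤ 2`)
  obtain ⟨D, hD, hsize, -, heval⟩ :=
    Circuit.exists_hardwire (show (0 : ℕ) ≤ 2 by omega) (show (0 : ℕ) ≤ 2 by omega) C hCB σ
  refine not_computes_hardFn hcard D hD (hsize.trans (by rw [hCs]; omega)) fun y => ?_
  rw [heval, hCf]
  -- the hard-wired input is `y 0^{n - ℓ n}`
  have hlist : List.ofFn (fun j => Sum.elim y id (σ j)) =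
      List.ofFn y ++ List.replicate (n - ℓ n) false := by
    apply List.ext_getElem
    · simp; omega
    · intro i h₁ h₂
      rw [List.getElem_ofFn]
      by_cases hi : i < ℓ n
      · simp only [σ, dif_pos hi, Sum.elim_inl]
        rw [List.getElem_append_left (by simpa using hi), List.getElem_ofFn]
      · simp only [σ, dif_neg hi, Sum.elim_inr, id]
        rw [List.getElem_append_right (by simpa using Nat.le_of_not_lt hi)]
        simp
  have hlen : (List.ofFn y ++ List.replicate (n - ℓ n) false).length = n := by simp; omega
  have hread : (fun i : Fin (ℓ n) => (List.ofFn y ++ List.replicate (n - ℓ n) false).getD i false) = y :=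
    funext fun i => getD_ofFn_append y _ i.2
  have hiff : List.ofFn y ++ List.replicate (n - ℓ n) false ∈ lang ℓ s ↔
      hardFn (ℓ n) (s n + 2) y = true := by
    rw [mem_lang_iff hlen, hread]
    exact ⟨fun h => h.2, fun h => ⟨hℓ, h⟩⟩
  show (lang ℓ s).boolIndicator (List.ofFn fun j => Sum.elim y id (σ j)) = hardFn (ℓ n) (s n + 2) y
  rw [hlist]
  by_cases hy : hardFn (ℓ n) (s n + 2) y = true
  · rw [hy]
    exact (Set.mem_iff_boolIndicator _ _).1 (hiff.2 hy)
  · rw [Bool.not_eq_true] at hy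
    rw [hy]
    exact (Set.notMem_iff_boolIndicator _ _).1 fun hm =>
      Bool.noConfusion (((hiff.1 hm).symm.trans hy))

/-- Eventual form: if the two side conditions hold at all large lengths, `lang ℓ s` has no
`s(n)`-size circuits at any large length. [cite: MurrayWilliams2018, Thm. 2.3] -/
theorem eventually_lt_circuitSize_lang {ℓ s : ℕ → ℕ}
    (h : ∀ᶠ n in atTop, ℓ n ≤ n ∧ Fintype.card (Code (ℓ n) (s n + 2)) < 2 ^ 2 ^ ℓ n) :
    ∀ᶠ n in atTop, s n < (lang ℓ s).circuitSize n :=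
  h.mono fun _ hn => lt_circuitSize_lang hn.1 hn.2

/-! ### The printed number of variables: `2^ℓ ≈ s²` -/

/-- `2(j+6) + 6 ≤ 2^{j+5}`. [folklore] -/
theorem two_mul_add_le_two_pow (j : ℕ) : 2 * (j + 6) + 6 ≤ 2 ^ (j + 5) := by
  induction j with
  | zero => norm_num
  | succ j ih =>
    have : 2 ^ (j + 1 + 5) = 2 * 2 ^ (j + 5) := by ring
    omega

/-- **Few codes against many tables**: if `(S + 2)² ≤ 2^ℓ`, `ℓ ≤ S + 2` and `S ≥ 32` then
`#Code ℓ S < 2^{2^ℓ}` — from `#Code ℓ S ≤ (S+1)(16(ℓ+S+1)²)ˢ(ℓ+S+1)` (`CircuitCount.card_code_le`)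
bounded by `(16 (2S+3)²)^{S+1} ≤ 2^{(2k+8)(S+1)}` for `2S + 3 ≤ 2^{k+2}`, `k = ⌊log₂ S⌋ + 1`, and
`(2k+8)(S+1) < (S+2)² ≤ 2^ℓ` since `2k + 6 ≤ 2^{k-1} ≤ S` for `k ≥ 6`. [folklore] -/
theorem card_code_lt_two_pow_of_le (hS : 32 ≤ S) (hℓS : ℓ ≤ S + 2) (hpow : (S + 2) ^ 2 ≤ 2 ^ ℓ) :
    Fintype.card (Code ℓ S) < 2 ^ 2 ^ ℓ := by
  obtain ⟨k, hk⟩ : ∃ k, Nat.size S = k := ⟨_, rfl⟩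
  have hSlt : S < 2 ^ k := hk ▸ Nat.lt_size_self S
  have hk6 : 6 ≤ k := by
    have : 5 < Nat.size S := Nat.lt_size.2 (by norm_num; omega)
    omega
  have hkS : 2 ^ (k - 1) ≤ S := by
    have : k - 1 < Nat.size S := by omega
    exact Nat.lt_size.1 this
  have h2k : 2 * k + 6 ≤ S := by
    obtain ⟨j, rfl⟩ : ∃ j, k = j + 6 := ⟨k - 6, by omega⟩
    have h := two_mul_add_le_two_pow j
    have hj : j + 6 - 1 = j + 5 := by omega
    rw [hj] at hkS
    omega
  have hM : 2 * S + 3 ≤ 2 ^ (k + 2) := by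
    have : 2 ^ (k + 2) = 4 * 2 ^ k := by ring
    omega
  have hM1 : ℓ + S + 1 ≤ 2 * S + 3 := by omega
  have h16 : 16 * (2 ^ (k + 2)) ^ 2 = 2 ^ (2 * k + 8) := by ring
  calc Fintype.card (Code ℓ S)
      ≤ (S + 1) * (16 * (ℓ + S + 1) ^ 2) ^ S * (ℓ + S + 1) := card_code_le ℓ S
    _ ≤ (S + 1) * (16 * (2 * S + 3) ^ 2) ^ S * (2 * S + 3) := by gcongr
    _ ≤ (16 * (2 * S + 3) ^ 2) ^ S * (16 * (2 * S + 3) ^ 2) := by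
        rw [mul_comm (S + 1), mul_assoc]
        apply Nat.mul_le_mul_left
        nlinarith
    _ = (16 * (2 * S + 3) ^ 2) ^ (S + 1) := by ring
    _ ≤ (16 * (2 ^ (k + 2)) ^ 2) ^ (S + 1) := by gcongr
    _ = 2 ^ ((2 * k + 8) * (S + 1)) := by rw [h16, ← pow_mul]
    _ < 2 ^ 2 ^ ℓ := by
        apply Nat.pow_lt_pow_right (by norm_num)
        calc (2 * k + 8) * (S + 1) ≤ (S + 2) * (S + 1) := Nat.mul_le_mul_right _ (by omega)
          _ < (S + 2) ^ 2 := by nlinarith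
          _ ≤ 2 ^ ℓ := hpow

/-- **The printed number of variables** `ℓ(S) := ⌈log₂ (S+2)²⌉` ("all Boolean functions
`f : {0,1}^{2 log s(n)} → {0,1}`"): the least `ℓ` with `(S+2)² ≤ 2^ℓ`.
[cite: MurrayWilliams2018, Thm. 2.3 (proof)] -/
def ellOf (S : ℕ) : ℕ :=
  Nat.clog 2 ((S + 2) ^ 2)

/-- `(S+2)² ≤ 2^{ℓ(S)}`. [folklore] -/
theorem sq_le_two_pow_ellOf (S : ℕ) : (S + 2) ^ 2 ≤ 2 ^ ellOf S :=
  Nat.le_pow_clog one_lt_two _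

/-- `ℓ(S) ≤ n` as soon as `(S+2)² ≤ 2ⁿ`. [folklore] -/
theorem ellOf_le_of_sq_le {S n : ℕ} (h : (S + 2) ^ 2 ≤ 2 ^ n) : ellOf S ≤ n :=
  Nat.clog_le_of_le_pow h

/-- `ℓ(S) ≤ S + 2` for `S ≥ 2` (`m² ≤ 2ᵐ` for `m = S + 2 ≥ 4`). [folklore] -/
theorem ellOf_le (hS : 2 ≤ S) : ellOf S ≤ S + 2 := by
  refine ellOf_le_of_sq_le ?_
  obtain ⟨j, hj⟩ : ∃ j, S + 2 = j + 4 := ⟨S - 2, by omega⟩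
  rw [hj]
  clear hj hS
  induction j with
  | zero => norm_num
  | succ j ih =>
    have h1 : 2 ^ (j + 1 + 4) = 2 * 2 ^ (j + 4) := by ring
    have h2 : (j + 1 + 4) ^ 2 + (j * j + 6 * j + 7) = 2 * (j + 4) ^ 2 := by ring
    omega

/-- **The diagonal language of Thm. 2.3 with the printed parameters**: at length `n`, the hard
function on `ℓ(s(n) + 2) = ⌈log₂ (s(n)+4)²⌉` variables against size `s(n) + 2`, read on the
first bits of the input. [cite: MurrayWilliams2018, Thm. 2.3] -/
def diag (s : ℕ → ℕ) : Language Bool :=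
  lang (fun n => ellOf (s n + 2)) s

/-- **Murray–Williams 2018, Thm. 2.3, circuit lower bound** (combinatorial half, greedy table):
at EVERY length `n` with `30 ≤ s(n)` and `(s(n) + 4)² ≤ 2ⁿ` (so that the `⌈log₂ (s(n)+4)²⌉`
variables fit into the input, as in the printed construction), the slice of `diag s` has
circuit complexity `> s(n)` over `B₂`. [cite: MurrayWilliams2018, Thm. 2.3] -/
theorem lt_circuitSize_diag {s : ℕ → ℕ} {n : ℕ} (h30 : 30 ≤ s n) (hn : (s n + 4) ^ 2 ≤ 2 ^ n) :
    s n < (diag s).circuitSize n := by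
  have hS : 32 ≤ s n + 2 := by omega
  have hn' : (s n + 2 + 2) ^ 2 ≤ 2 ^ n := by simpa [add_assoc] using hn
  refine lt_circuitSize_lang (ℓ := fun n => ellOf (s n + 2)) (ellOf_le_of_sq_le hn') ?_
  exact card_code_lt_two_pow_of_le hS (ellOf_le (by omega)) (sq_le_two_pow_ellOf _)

/-- Eventual form of Thm. 2.3's lower bound: if `30 ≤ s(n)` and `(s(n) + 4)² ≤ 2ⁿ` for all
large `n` (every unbounded circuit-size function with `2 log₂ (s(n)+4) ≤ n`), then
`s(n) < (diag s).circuitSize n` for all sufficiently large `n` ("does not have `s(n)`-size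
circuits for all but finitely many input lengths `n`"). [cite: MurrayWilliams2018, Thm. 2.3] -/
theorem eventually_lt_circuitSize_diag {s : ℕ → ℕ}
    (h : ∀ᶠ n in atTop, 30 ≤ s n ∧ (s n + 4) ^ 2 ≤ 2 ^ n) :
    ∀ᶠ n in atTop, s n < (diag s).circuitSize n :=
  h.mono fun _ hn => lt_circuitSize_diag hn.1 hn.2

end GreedyHard

end Literature.Computability.Complexity

end
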